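import Literature.Barriers.CriticalPhenomena.PlaquetteWalkHoleRootExtremeRunShape
import Literature.Barriers.CriticalPhenomena.PlaquetteWalkHoleRootRightColumn
import HarnessLib

/-!
# Barrier catalogue (SAWScalingLimit): the FRAME of a cost-`5` wound walk — at least two of its five isolated turns are CORNERS (in an
extreme row and an extreme column), and its middle isolated turn lies in an extreme column («FRAME»)

Combination of `PlaquetteWalkHoleRootExtremeRunShape` (cost `5`: exactly two isolated turns in the top row, two in the bottom row, at most
one strictly between) with `PlaquetteWalkHoleRootExtremeColumns` / `PlaquetteWalkHoleRootRightColumn` (two isolated turns in the leftmost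
column, or one and a slanted end there; same for the rightmost; the two columns differ since `X_min ≤ w.1 − 2 < w.1 ≤ X_max`).

* ★★ `ΩG.column_turns_in_extreme_rows_of_cost_five`: at limit cost `5`, of any finset of isolated-turn plaquettes lying in the two extreme
  columns, all but at most `slotDeg z` (≤ 1) lie in the extreme rows;
* ★★★ `ΩG.two_corners_of_cost_five`: a cost-`5` wound class-`B2a` walk has (at least) TWO CORNER plaquettes — isolated turns lying in an
  extreme row and in an extreme column.

DESIGN-next b-engine-1 g24 §2ter: the step before the run decomposition (R3) of the «rectangle» classification.
[GlazmanManolescu2019 §1 Fig. 1, Lemma 2.1, Remark 2.2; Glazman 2015 Lemma 3.1 (proof, pp. 6–7); Courant–Robbins, even–odd rule]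
-/

noncomputable section

namespace Literature.Probability.RandomPlanarGeometry.SAW.YangBaxter

open Real
open Literature.Barriers.CriticalPhenomena.PlaquetteWalk

namespace ΩG

variable {D : Set Face} {w r : Face} {ω : ΩG D (w.side .W) r}

/-- ★★ **COLUMN TURNS OF A COST-`5` WALK LIE IN THE EXTREME ROWS, ALL BUT AT MOST ONE**: for a wound class-`B2a` walk of limit cost `5` with
extreme rows `Y' < w.2 < Y`, a finset of `[corner]`/`[coCorner]` plaquettes none of which lies in row `Y` or row `Y'` has at most
`slotDeg (slotOfSide z)` elements (`turn_profile_of_cost_five`); in particular so does any finset of extreme-COLUMN turn plaquettes off the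
extreme rows. [cite: GlazmanManolescu2019, §1, Fig. 1 and eq. (1); Lemma 2.1] -/
theorem column_turns_in_extreme_rows_of_cost_five (hh : holeFaceW w ∉ D) (hr : RootedFace D (w.side .W) r) (h : ω.IsB2a)
    (hA : ω.AJ hr h (toC (midPt (w.side .W))) ≠ 0) (hc : cost (slotOfSide ω.1) ω.2.mids = 5) :
    ∃ Y Y' : ℤ, Y' < w.2 ∧ w.2 < Y ∧ (∀ j < ω.2.arcs.length, (ω.2.fc j).2 ≤ Y) ∧ (∀ j < ω.2.arcs.length, Y' ≤ (ω.2.fc j).2) ∧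
      ∀ T : Finset Face,
        (∀ f ∈ T, f ∈ facesL ω.2.mids ∧ (kindsL ω.2.mids f = [.corner] ∨ kindsL ω.2.mids f = [.coCorner])) →
        (∀ f ∈ T, f.2 ≠ Y ∧ f.2 ≠ Y') → T.card ≤ slotDeg (slotOfSide ω.1) := by
  classical
  obtain ⟨Y, Y', hY'w, hYw, hY, hY', hprof, -⟩ := turn_profile_of_cost_five hh hr h hA hc
  refine ⟨Y, Y', hY'w, hYw, hY, hY', fun T hT hTm => ?_⟩
  refine (hprof T hT).2.2 fun f hf => ?_
  obtain ⟨hfm, -⟩ := hT f hf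
  obtain ⟨m, hm, rfl⟩ := ω.2.exists_fc_eq_of_mem_facesL hfm
  obtain ⟨h1, h2⟩ := hTm _ hf
  exact ⟨lt_of_le_of_ne (hY' m hm) (fun e => h2 e.symm), lt_of_le_of_ne (hY m hm) h1⟩

/-- ★★★ **TWO CORNERS.** A wound class-`B2a` walk from the hole root `w.side W` of limit cost `5` has at least TWO isolated-turn plaquettes
that are CORNERS of its frame: each lies in an extreme row (topmost or bottommost) AND in an extreme column (leftmost or rightmost).
(Leftmost and rightmost columns carry ≥ 2 + 2 isolated turns — or one fewer with a slanted end in that column, not in both —, the two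
columns are different, and at most one of these column turns is off the extreme rows.) [cite: GlazmanManolescu2019, §1, Fig. 1 and eq. (1); Lemma 2.1; Remark 2.2]
[cite: Glazman2015WeightedSAW, Lemma 3.1 (proof, pp. 6–7)] [cite: CourantRobbins1958, Ch. V Appendix §2 (the even–odd rule)] -/
theorem two_corners_of_cost_five (hh : holeFaceW w ∉ D) (hr : RootedFace D (w.side .W) r) (h : ω.IsB2a)
    (hA : ω.AJ hr h (toC (midPt (w.side .W))) ≠ 0) (hc : cost (slotOfSide ω.1) ω.2.mids = 5) :
    ∃ Y Y' Xl Xr : ℤ, Y' < w.2 ∧ w.2 < Y ∧ Xl ≤ w.1 - 2 ∧ w.1 ≤ Xr ∧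
      (∀ j < ω.2.arcs.length, (ω.2.fc j).2 ≤ Y ∧ Y' ≤ (ω.2.fc j).2 ∧ Xl ≤ (ω.2.fc j).1 ∧ (ω.2.fc j).1 ≤ Xr) ∧
      ∃ C : Finset Face, 2 ≤ C.card ∧
        ∀ f ∈ C, f ∈ facesL ω.2.mids ∧ (kindsL ω.2.mids f = [.corner] ∨ kindsL ω.2.mids f = [.coCorner]) ∧
          (f.2 = Y ∨ f.2 = Y') ∧ (f.1 = Xl ∨ f.1 = Xr) := by
  classical
  obtain ⟨Y, Y', hY'w, hYw, hY, hY', hmid⟩ := column_turns_in_extreme_rows_of_cost_five hh hr h hA hc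
  obtain ⟨Xl, hXlw, hXl, Tl, hTl, hcl, hcardl⟩ := two_left_turns hh hr h hA
  obtain ⟨Xr, hXrw, hXr, Tr, hTr, hcr, hcardr⟩ := two_right_turns hh hr h
  have hs : slotDeg (slotOfSide ω.1) ≤ 1 := by unfold slotDeg; split_ifs <;> omega
  -- the column turns: at least three of them, since the two «end» exceptions exclude each other (`Xl < Xr`)
  have hdisj : Disjoint Tl Tr := by
    rw [Finset.disjoint_left]; intro f h1 h2; have e1 := hcl f h1; have e2 := hcr f h2; omega
  have h3 : 3 ≤ (Tl ∪ Tr).card := by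
    rw [Finset.card_union_of_disjoint hdisj]
    rcases hcardl with hl | ⟨hl, -, hrl⟩ <;> rcases hcardr with hr' | ⟨hr', -, hrr⟩ <;> omega
  -- those off the extreme rows are at most one
  set M := (Tl ∪ Tr).filter (fun f => f.2 ≠ Y ∧ f.2 ≠ Y') with hM
  have hMle : M.card ≤ 1 :=
    (hmid M (fun f hf => by
        rcases Finset.mem_union.1 (Finset.mem_filter.1 hf).1 with h1 | h1
        · exact hTl f h1
        · exact hTr f h1)
      (fun f hf => (Finset.mem_filter.1 hf).2)).trans hs
  -- the corners: the column turns in the extreme rows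
  set C := (Tl ∪ Tr).filter (fun f => ¬(f.2 ≠ Y ∧ f.2 ≠ Y')) with hC
  have hsplit : (Tl ∪ Tr).card = C.card + M.card := by
    rw [hC, hM, ← Finset.card_filter_add_card_filter_not (fun f => ¬(f.2 ≠ Y ∧ f.2 ≠ Y'))]
    congr 1
    exact congrArg Finset.card (Finset.filter_congr fun f _ => by simp only [not_not])
  refine ⟨Y, Y', Xl, Xr, hY'w, hYw, hXlw, hXrw, fun j hj => ⟨hY j hj, hY' j hj, hXl j hj, hXr j hj⟩, C, by omega, fun f hf => ?_⟩
  obtain ⟨hfu, hfrow⟩ := Finset.mem_filter.1 hf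
  have hrow : f.2 = Y ∨ f.2 = Y' := by
    by_contra hne; push Not at hne; exact hfrow ⟨hne.1, hne.2⟩
  rcases Finset.mem_union.1 hfu with h1 | h1
  · exact ⟨(hTl f h1).1, (hTl f h1).2, hrow, Or.inl (hcl f h1)⟩
  · exact ⟨(hTr f h1).1, (hTr f h1).2, hrow, Or.inr (hcr f h1)⟩

end ΩG

end Literature.Probability.RandomPlanarGeometry.SAW.YangBaxter
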